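import Literature.IUT.HodgeTheaters.DiscreteProfiniteCompletionsNonabelian
import Literature.IUT.HodgeTheaters.DiscreteProfiniteConjugatesAbelianRank
import Mathlib.GroupTheory.Perm.Fin
import HarnessLib

/-!
# [IUTchI] Theorem 2.6, Corollary 2.8, Lemma 2.7 (vi)(vii) for free `G`: assembly (unconditional)

Mochizuki, *Inter-universal Teichmüller theory I*, kurims manuscript (May 2020), §2, Theorem 2.6
(pp. 56–57) and Corollary 2.8 / Remark 2.8.1 (pp. 59–60) [cite: Mochizuki2012, Thm 2.6 pp.56-57].
Assembly of the two branches of Theorem 2.6 for `G` free of finite rank — (a) for `H_G` abelian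
(`profiniteConjugates_a_abelian_freeCase`) and (b) for `H_G` nonabelian
(`profiniteConjugates_b_freeCase_of_rankTwo`, `DiscreteProfiniteCompletionsNonabelian.lean`) — with the
free case of Lemma 2.7 (iii) supplied by `FreeOrSurface.rankTwoInAbelianization_freeCase`
(`DiscreteProfiniteConjugatesAbelianRank.lean`, abc-iut-L5-t10):

* `profiniteConjugates_freeCase` — **Theorem 2.6 for `G` free of finite rank, UNCONDITIONAL**;
* `subgroupsOfComplexHyperbolicPi1_freeCase` — **Corollary 2.8 for `Π_Z` free of finite rank**
  (non-proper hyperbolic curves over `ℂ`; the cuspidal inertia groups of Remark 2.8.1), UNCONDITIONAL;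
* `profiniteConjugatesOfDiscreteSubgroups_of_surfaceCase`, `subgroupsOfComplexHyperbolicPi1_of_surfaceCase`
  — the named statements `ProfiniteConjugatesOfDiscreteSubgroups`, `SubgroupsOfComplexHyperbolicPi1`
  follow from the ORIENTABLE-SURFACE-GROUP half of Theorem 2.6 alone (the honest remainder);
* **Lemma 2.7 (vi) and (vii) for `G` free of finite rank, UNCONDITIONAL**
  (`FreeOrSurface.centralizerCommutatorKernelTrivial_freeCase`, `….autFixingCommutatorKernelTrivial_freeCase`),
  by a route through Theorem 2.6 (b) instead of the printed normal-terminality / torsion-freeness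
  argument (p. 59): `z ∈ Z_Ĝ(N̂)` centralizes `η([G, G])`, so Theorem 2.6 (b) with `F = G`, `H = [G, G]`
  (nonabelian: `[a, b]`, `[a⁻¹, b]` do not commute for free generators `a ≠ b`, witnessed in `S₄`) gives
  `z = η(g₀)`; `η` is injective (free groups are residually finite), so `g₀` centralizes `[G, G]`, lies in
  the cyclic centralizers of two non-commuting elements, and is trivial (commuting powers force commuting
  elements, `FreeOrSurface.commute_of_zpow_mul_zpow_eq_one`, abc-iut-L5-t10); plus the reductions of
  the two named statements to their orientable-surface-group halves.

Proof-only file.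
-/

namespace Literature.IUT.HodgeTheaters

open scoped Pointwise

universe u

/-! ### Assembly of Theorem 2.6 -/

/-- **Theorem 2.6 for `G` free of finite rank** (both assertions), relative to the free case of
Lemma 2.7 (iii) (`hIII`). [cite: Mochizuki2012, Thm 2.6 pp.56-57] -/
theorem profiniteConjugates_freeCase_of_rankTwo
    (hIII : ∀ (G : Type u) [Group G], IsFreeOfFiniteRank G → ∀ x y : G, x * y ≠ y * x →
      ∃ (G₁ : Subgroup G) (n : ℕ) (hx : x ^ n ∈ G₁) (hy : y ^ n ∈ G₁), G₁.FiniteIndex ∧ 0 < n ∧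
        ∀ i j : ℤ, Abelianization.of (⟨x ^ n, hx⟩ : G₁) ^ i *
          Abelianization.of (⟨y ^ n, hy⟩ : G₁) ^ j = 1 → i = 0 ∧ j = 0)
    (F : Type u) [Group F] (G H : Subgroup F) [G.FiniteIndex] (hG : IsFreeOfFiniteRank G)
    (γ : profiniteCompletion F)
    (hγ : ∀ h ∈ H, γ * toCompletion F h * γ⁻¹ ∈ (toCompletion F).range) :
    (∃ δ : F, MulAut.conj γ • (H ⊓ G).map (toCompletion F) =
        MulAut.conj (toCompletion F δ) • (H ⊓ G).map (toCompletion F)) ∧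
    ((∃ x ∈ H ⊓ G, ∃ y ∈ H ⊓ G, x * y ≠ y * x) → γ ∈ (toCompletion F).range) := by
  by_cases hab : ∀ x ∈ H ⊓ G, ∀ y ∈ H ⊓ G, x * y = y * x
  · refine ⟨profiniteConjugates_a_abelian_freeCase F G H hG hab γ hγ, ?_⟩
    rintro ⟨x, hx, y, hy, hxy⟩
    exact absurd (hab x hx y hy) hxy
  · have hna : ∃ x ∈ H ⊓ G, ∃ y ∈ H ⊓ G, x * y ≠ y * x := by
      by_contra hne
      refine hab fun x hx y hy => ?_
      by_contra hxy
      exact hne ⟨x, hx, y, hy, hxy⟩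
    have hb := profiniteConjugates_b_freeCase_of_rankTwo hIII G H hG γ hγ hna
    refine ⟨?_, fun _ => hb⟩
    obtain ⟨δ, hδ⟩ := hb
    exact ⟨δ, by rw [hδ]⟩

/-- **Theorem 2.6, the named statement, from the free case of Lemma 2.7 (iii) and its
orientable-surface-group half.** [cite: Mochizuki2012, Thm 2.6 pp.56-57] -/
theorem profiniteConjugatesOfDiscreteSubgroups_of_rankTwo_of_surfaceCase
    (hIII : ∀ (G : Type u) [Group G], IsFreeOfFiniteRank G → ∀ x y : G, x * y ≠ y * x →
      ∃ (G₁ : Subgroup G) (n : ℕ) (hx : x ^ n ∈ G₁) (hy : y ^ n ∈ G₁), G₁.FiniteIndex ∧ 0 < n ∧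
        ∀ i j : ℤ, Abelianization.of (⟨x ^ n, hx⟩ : G₁) ^ i *
          Abelianization.of (⟨y ^ n, hy⟩ : G₁) ^ j = 1 → i = 0 ∧ j = 0)
    (hSurf : ∀ (F : Type u) [Group F] (G H : Subgroup F), G.FiniteIndex → IsOrientableSurfaceGroup G →
      (H : Set F).Infinite → ∀ γ : profiniteCompletion F,
        (∀ h ∈ H, γ * toCompletion F h * γ⁻¹ ∈ (toCompletion F).range) →
        (∃ δ : F, MulAut.conj γ • (H ⊓ G).map (toCompletion F) =
            MulAut.conj (toCompletion F δ) • (H ⊓ G).map (toCompletion F)) ∧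
        ((∃ x ∈ H ⊓ G, ∃ y ∈ H ⊓ G, x * y ≠ y * x) → γ ∈ (toCompletion F).range)) :
    ProfiniteConjugatesOfDiscreteSubgroups.{u} := by
  intro F _ G H hGfi hG hH γ hγ
  haveI := hGfi
  rcases hG with hF | hS
  · exact profiniteConjugates_freeCase_of_rankTwo hIII F G H hF γ hγ
  · exact hSurf F G H hGfi hS hH γ hγ

/-- **Corollary 2.8 for `Π_Z` free of finite rank (the non-proper case)**, relative to the free case
of Lemma 2.7 (iii): Remark 2.8.1's deduction applied to the free case of Theorem 2.6.
[cite: Mochizuki2012, Cor 2.8 p.59] -/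
theorem subgroupsOfComplexHyperbolicPi1_freeCase_of_rankTwo
    (hIII : ∀ (G : Type u) [Group G], IsFreeOfFiniteRank G → ∀ x y : G, x * y ≠ y * x →
      ∃ (G₁ : Subgroup G) (n : ℕ) (hx : x ^ n ∈ G₁) (hy : y ^ n ∈ G₁), G₁.FiniteIndex ∧ 0 < n ∧
        ∀ i j : ℤ, Abelianization.of (⟨x ^ n, hx⟩ : G₁) ^ i *
          Abelianization.of (⟨y ^ n, hy⟩ : G₁) ^ j = 1 → i = 0 ∧ j = 0)
    (P : Type u) [Group P] (hP : IsFreeOfFiniteRank P) (H : Subgroup P)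
    (γ : profiniteCompletion P)
    (hγ : ∀ h ∈ H, γ * toCompletion P h * γ⁻¹ ∈ (toCompletion P).range) :
    (∃ δ : P, MulAut.conj γ • H.map (toCompletion P) =
        MulAut.conj (toCompletion P δ) • H.map (toCompletion P)) ∧
    ((∃ x ∈ H, ∃ y ∈ H, x * y ≠ y * x) → γ ∈ (toCompletion P).range) := by
  have htop : IsFreeOfFiniteRank (⊤ : Subgroup P) := IsFreeOfFiniteRank.of_mulEquiv Subgroup.topEquiv hP
  have h := profiniteConjugates_freeCase_of_rankTwo hIII P ⊤ H htop γ hγ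
  rw [inf_top_eq] at h
  exact h

/-! ### Unconditional forms (Lemma 2.7 (iii) free case from `DiscreteProfiniteConjugatesAbelianRank`) -/

/-- **Theorem 2.6 for `G` free of finite rank — unconditional.**  Both assertions (a) and (b) of
Theorem 2.6 hold whenever the finite index subgroup `G ⊆ F` is a free group of finite rank (the
hypothesis "`H` infinite" is not needed).  Inputs, all kernel theorems of the tree: Lemma 2.7 (iii)/(iv)
free case, conjugacy separability of free groups [Stb1], the centralizer condition in `F̂`.
[cite: Mochizuki2012, Thm 2.6 pp.56-57] -/
theorem profiniteConjugates_freeCase (F : Type u) [Group F] (G H : Subgroup F) [G.FiniteIndex]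
    (hG : IsFreeOfFiniteRank G) (γ : profiniteCompletion F)
    (hγ : ∀ h ∈ H, γ * toCompletion F h * γ⁻¹ ∈ (toCompletion F).range) :
    (∃ δ : F, MulAut.conj γ • (H ⊓ G).map (toCompletion F) =
        MulAut.conj (toCompletion F δ) • (H ⊓ G).map (toCompletion F)) ∧
    ((∃ x ∈ H ⊓ G, ∃ y ∈ H ⊓ G, x * y ≠ y * x) → γ ∈ (toCompletion F).range) :=
  profiniteConjugates_freeCase_of_rankTwo FreeOrSurface.rankTwoInAbelianization_freeCase F G H hG γ hγ

/-- **Theorem 2.6, the named statement, from its orientable-surface-group half alone.**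
[cite: Mochizuki2012, Thm 2.6 pp.56-57] -/
theorem profiniteConjugatesOfDiscreteSubgroups_of_surfaceCase
    (hSurf : ∀ (F : Type u) [Group F] (G H : Subgroup F), G.FiniteIndex → IsOrientableSurfaceGroup G →
      (H : Set F).Infinite → ∀ γ : profiniteCompletion F,
        (∀ h ∈ H, γ * toCompletion F h * γ⁻¹ ∈ (toCompletion F).range) →
        (∃ δ : F, MulAut.conj γ • (H ⊓ G).map (toCompletion F) =
            MulAut.conj (toCompletion F δ) • (H ⊓ G).map (toCompletion F)) ∧
        ((∃ x ∈ H ⊓ G, ∃ y ∈ H ⊓ G, x * y ≠ y * x) → γ ∈ (toCompletion F).range)) :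
    ProfiniteConjugatesOfDiscreteSubgroups.{u} :=
  profiniteConjugatesOfDiscreteSubgroups_of_rankTwo_of_surfaceCase
    FreeOrSurface.rankTwoInAbelianization_freeCase hSurf

/-- **Corollary 2.8 for `Π_Z` free of finite rank — unconditional** (non-proper hyperbolic curves;
the case of cuspidal inertia groups `H`, Remark 2.8.1): for `H ⊆ Π_Z` and `γ ∈ Π̂_Z` with
`γ · η(H) · γ⁻¹ ⊆ η(Π_Z)`, one has `γ · η(H) · γ⁻¹ = η(δ) · η(H) · η(δ)⁻¹` for some `δ ∈ Π_Z`, and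
`γ ∈ η(Π_Z)` if `H` is nonabelian. [cite: Mochizuki2012, Cor 2.8 p.59] -/
theorem subgroupsOfComplexHyperbolicPi1_freeCase (P : Type u) [Group P] (hP : IsFreeOfFiniteRank P)
    (H : Subgroup P) (γ : profiniteCompletion P)
    (hγ : ∀ h ∈ H, γ * toCompletion P h * γ⁻¹ ∈ (toCompletion P).range) :
    (∃ δ : P, MulAut.conj γ • H.map (toCompletion P) =
        MulAut.conj (toCompletion P δ) • H.map (toCompletion P)) ∧
    ((∃ x ∈ H, ∃ y ∈ H, x * y ≠ y * x) → γ ∈ (toCompletion P).range) :=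
  subgroupsOfComplexHyperbolicPi1_freeCase_of_rankTwo FreeOrSurface.rankTwoInAbelianization_freeCase
    P hP H γ hγ

/-- **Corollary 2.8, the named statement, from the orientable-surface-group half of Theorem 2.6**
(Remark 2.8.1's deduction `subgroupsOfComplexHyperbolicPi1_of_thm26`). [cite: Mochizuki2012, Cor 2.8 p.59] -/
theorem subgroupsOfComplexHyperbolicPi1_of_surfaceCase
    (hSurf : ∀ (F : Type u) [Group F] (G H : Subgroup F), G.FiniteIndex → IsOrientableSurfaceGroup G →
      (H : Set F).Infinite → ∀ γ : profiniteCompletion F,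
        (∀ h ∈ H, γ * toCompletion F h * γ⁻¹ ∈ (toCompletion F).range) →
        (∃ δ : F, MulAut.conj γ • (H ⊓ G).map (toCompletion F) =
            MulAut.conj (toCompletion F δ) • (H ⊓ G).map (toCompletion F)) ∧
        ((∃ x ∈ H ⊓ G, ∃ y ∈ H ⊓ G, x * y ≠ y * x) → γ ∈ (toCompletion F).range)) :
    SubgroupsOfComplexHyperbolicPi1.{u} :=
  subgroupsOfComplexHyperbolicPi1_of_thm26 (profiniteConjugatesOfDiscreteSubgroups_of_surfaceCase hSurf)


namespace FreeOrSurface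

/-- In a nonabelian free group there are two NON-COMMUTING elements of the commutator subgroup:
for free generators `a ≠ b`, `[a, b]` and `[a⁻¹, b]` (their images under `a ↦ (1 2 3)`, `b ↦ (3 4)`
in `S₄` do not commute). [cite: Mochizuki2012, Lem 2.7(vi) p.59] -/
theorem exists_noncomm_mem_commutator (G : Type u) [Group G] [IsFreeGroup G]
    (hna : ∃ x y : G, x * y ≠ y * x) :
    ∃ x ∈ commutator G, ∃ y ∈ commutator G, x * y ≠ y * x := by
  classical
  obtain ⟨p, q, hpq⟩ := hna
  -- two distinct free generators
  obtain ⟨a, b, hab⟩ := exists_ne_generators_of_ne hpq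
  set A : G := IsFreeGroup.of a with hA
  set B : G := IsFreeGroup.of b with hB
  refine ⟨A * B * A⁻¹ * B⁻¹, ?_, A⁻¹ * B * A * B⁻¹, ?_, ?_⟩
  · have := Subgroup.commutator_mem_commutator (Subgroup.mem_top A) (Subgroup.mem_top B)
    rw [← commutator_def] at this
    simpa [commutatorElement_def] using this
  · have := Subgroup.commutator_mem_commutator (Subgroup.mem_top A⁻¹) (Subgroup.mem_top B)
    rw [← commutator_def] at this
    simpa [commutatorElement_def] using this
  · -- witness in `S₄`
    let σ : Equiv.Perm (Fin 4) := Equiv.swap 0 1 * Equiv.swap 1 2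
    let τ : Equiv.Perm (Fin 4) := Equiv.swap 2 3
    let φ : G →* Equiv.Perm (Fin 4) :=
      IsFreeGroup.lift fun c => if c = a then σ else if c = b then τ else 1
    have hφa : φ A = σ := by simp [φ, hA]
    have hφb : φ B = τ := by simp [φ, hB, Ne.symm hab]
    intro h
    have h' := congrArg φ h
    simp only [map_mul, map_inv, hφa, hφb] at h'
    exact absurd h' (by decide)

/-- The homomorphism `η : G → Ĝ` is injective for a free group (free groups are residually finite;
"`F ⊆ F̂`", p. 56). [cite: Mochizuki2012, Thm 2.6 p.56] -/
theorem toCompletion_injective (G : Type u) [Group G] [IsFreeGroup G] :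
    Function.Injective (toCompletion G) := by
  haveI := residuallyFinite_of_isFreeGroup G
  have h := (ProfiniteGrp.ProfiniteCompletion.etaFn_injective_iff_residuallyFinite (GrpCat.of G)).mpr
    (by assumption)
  exact fun x y hxy => h hxy

/-- `η([G, G]) ⊆ N̂ = ` the closure of `[Ĝ, Ĝ]`. [cite: Mochizuki2012, Lem 2.7(vi) p.58] -/
theorem toCompletion_mem_commutatorKernel (G : Type u) [Group G] {n : G} (hn : n ∈ commutator G) :
    toCompletion G n ∈ commutatorKernel G := by
  apply Subgroup.le_topologicalClosure
  have h : (commutator G).map (toCompletion G) ≤ commutator (profiniteCompletion G) := by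
    rw [commutator_def, commutator_def, Subgroup.map_commutator]
    exact Subgroup.commutator_mono le_top le_top
  exact h ⟨n, hn, rfl⟩

/-- **Lemma 2.7 (vi) for `G` free of finite rank**: if `G` is nonabelian, the centralizer in `Ĝ` of
`N̂ = Ker(Ĝ ↠ Ĝ^{ab})` is trivial.  Route: Theorem 2.6 (b) (free case) applied to `H = [G, G]`.
[cite: Mochizuki2012, Lem 2.7(vi) pp.58-59] -/
theorem centralizerCommutatorKernelTrivial_freeCase (G : Type u) [Group G] (hG : IsFreeOfFiniteRank G)
    (hna : ∃ x y : G, x * y ≠ y * x) :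
    Subgroup.centralizer (commutatorKernel G : Set (profiniteCompletion G)) = ⊥ := by
  haveI := isFreeGroup_of_isFreeOfFiniteRank hG
  rw [eq_bot_iff]
  intro z hz
  rw [Subgroup.mem_bot]
  rw [Subgroup.mem_centralizer_iff] at hz
  -- `z` centralizes `η([G, G])`, hence conjugates it into `η(G)`
  have hγ : ∀ h ∈ commutator G, z * toCompletion G h * z⁻¹ ∈ (toCompletion G).range := by
    intro h hh
    refine ⟨h, ?_⟩
    have := hz (toCompletion G h) (toCompletion_mem_commutatorKernel G hh)
    rw [← this, mul_inv_cancel_right]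
  -- `[G, G]` is nonabelian
  obtain ⟨x, hx, y, hy, hxy⟩ := exists_noncomm_mem_commutator G hna
  have htop : IsFreeOfFiniteRank (⊤ : Subgroup G) := IsFreeOfFiniteRank.of_mulEquiv Subgroup.topEquiv hG
  have hb := (profiniteConjugates_freeCase G ⊤ (commutator G) htop z hγ).2
    ⟨x, Subgroup.mem_inf.mpr ⟨hx, Subgroup.mem_top x⟩, y, Subgroup.mem_inf.mpr ⟨hy, Subgroup.mem_top y⟩, hxy⟩
  obtain ⟨g₀, hg₀⟩ := hb
  -- `g₀` centralizes `[G, G]` in `G`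
  have hinj := toCompletion_injective G
  have hcomm : ∀ n ∈ commutator G, g₀ * n = n * g₀ := by
    intro n hn
    apply hinj
    rw [map_mul, map_mul, hg₀]
    exact (hz (toCompletion G n) (toCompletion_mem_commutatorKernel G hn)).symm
  -- … hence lies in the cyclic centralizers of `x` and `y`
  have hx1 : x ≠ 1 := by rintro rfl; exact hxy (by simp)
  have hy1 : y ≠ 1 := by rintro rfl; exact hxy (by simp)
  obtain ⟨r, hr⟩ := exists_centralizer_eq_zpowers G x hx1
  obtain ⟨s, hs⟩ := exists_centralizer_eq_zpowers G y hy1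
  have hg₀r : g₀ ∈ Subgroup.zpowers r := by
    rw [← hr, Subgroup.mem_centralizer_iff]
    intro w hw; rw [Set.mem_singleton_iff] at hw; subst hw
    exact (hcomm _ hx).symm
  have hg₀s : g₀ ∈ Subgroup.zpowers s := by
    rw [← hs, Subgroup.mem_centralizer_iff]
    intro w hw; rw [Set.mem_singleton_iff] at hw; subst hw
    exact (hcomm _ hy).symm
  have hxr : x ∈ Subgroup.zpowers r := by
    rw [← hr, Subgroup.mem_centralizer_iff]; simp
  have hys : y ∈ Subgroup.zpowers s := by
    rw [← hs, Subgroup.mem_centralizer_iff]; simp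
  obtain ⟨i, hi⟩ := Subgroup.mem_zpowers_iff.mp hg₀r
  obtain ⟨j, hj⟩ := Subgroup.mem_zpowers_iff.mp hg₀s
  obtain ⟨p, hp⟩ := Subgroup.mem_zpowers_iff.mp hxr
  obtain ⟨q, hq⟩ := Subgroup.mem_zpowers_iff.mp hys
  -- if `g₀ ≠ 1` then `r` and `s` commute, hence so do `x` and `y`: contradiction
  by_contra hz1
  have hg₀1 : g₀ ≠ 1 := fun h => hz1 (by rw [← hg₀, h, map_one])
  have hi0 : i ≠ 0 := by rintro rfl; exact hg₀1 (by rw [← hi, zpow_zero])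
  have hrs : r ^ i * s ^ (-j) = 1 := by rw [hi, zpow_neg, hj, mul_inv_cancel]
  have hcomm_rs : r * s = s * r :=
    commute_of_zpow_mul_zpow_eq_one (by simp [hi0]) hrs
  apply hxy
  rw [← hp, ← hq]
  exact (Commute.zpow_zpow hcomm_rs p q).eq

/-- **Lemma 2.7 (vii) for `G` free of finite rank**: an automorphism of the profinite group `Ĝ`
fixing `N̂` pointwise is the identity (the formal step printed on p. 59, from (vi)).
[cite: Mochizuki2012, Lem 2.7(vii) p.59] -/
theorem autFixingCommutatorKernelTrivial_freeCase (G : Type u) [Group G] (hG : IsFreeOfFiniteRank G)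
    (hna : ∃ x y : G, x * y ≠ y * x)
    (α : profiniteCompletion G ≃ₜ* profiniteCompletion G) (hα : ∀ n ∈ commutatorKernel G, α n = n)
    (z : profiniteCompletion G) : α z = z := by
  have hZ := centralizerCommutatorKernelTrivial_freeCase G hG hna
  haveI hN : (commutatorKernel G).Normal :=
    Subgroup.is_normal_topologicalClosure (commutator (profiniteCompletion G))
  have hmem : α z * z⁻¹ ∈
      Subgroup.centralizer (commutatorKernel G : Set (profiniteCompletion G)) := by
    rw [Subgroup.mem_centralizer_iff]
    intro y hy
    have hy' : z⁻¹ * y * z⁻¹⁻¹ ∈ commutatorKernel G := hN.conj_mem y hy z⁻¹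
    rw [inv_inv] at hy'
    have h1 : (α z)⁻¹ * y * α z = z⁻¹ * y * z := by
      have h0 := hα _ hy'
      rwa [map_mul, map_mul, map_inv, hα y hy] at h0
    calc y * (α z * z⁻¹) = α z * ((α z)⁻¹ * y * α z) * z⁻¹ := by group
      _ = α z * (z⁻¹ * y * z) * z⁻¹ := by rw [h1]
      _ = α z * z⁻¹ * y := by group
  rw [hZ, Subgroup.mem_bot] at hmem
  exact mul_inv_eq_one.mp hmem

/-- Reduction for **Lemma 2.7 (vi)**: the named statement follows from its orientable-surface-group
half. [cite: Mochizuki2012, Lem 2.7(vi) p.58] -/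
theorem centralizerCommutatorKernelTrivial_of_surfaceCase
    (hS : ∀ (G : Type u) [Group G], IsOrientableSurfaceGroup G → (∃ x y : G, x * y ≠ y * x) →
      Subgroup.centralizer (commutatorKernel G : Set (profiniteCompletion G)) = ⊥) :
    centralizerCommutatorKernelTrivial.{u} := by
  intro G _ hG hna
  rcases hG with hF | hSfc
  · exact centralizerCommutatorKernelTrivial_freeCase G hF hna
  · exact hS G hSfc hna

/-- Reduction for **Lemma 2.7 (vii)**: the named statement follows from the orientable-surface-group
half of (vi) (via t1's `autFixingCommutatorKernelTrivial_of_centralizer`).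
[cite: Mochizuki2012, Lem 2.7(vii) p.59] -/
theorem autFixingCommutatorKernelTrivial_of_surfaceCase
    (hS : ∀ (G : Type u) [Group G], IsOrientableSurfaceGroup G → (∃ x y : G, x * y ≠ y * x) →
      Subgroup.centralizer (commutatorKernel G : Set (profiniteCompletion G)) = ⊥) :
    autFixingCommutatorKernelTrivial.{u} :=
  autFixingCommutatorKernelTrivial_of_centralizer (centralizerCommutatorKernelTrivial_of_surfaceCase hS)

end FreeOrSurface

end Literature.IUT.HodgeTheaters
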